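import Literature.Topology.FourManifolds.SchoenfliesIsotopy
import Literature.Topology.FourManifolds.SchoenfliesSphereThreeHolds
import HarnessLib

/-!
# Discharges of named facts of `SchoenfliesSphereThree.lean`

`Literature/Topology/FourManifolds/SchoenfliesSphereThreeDischarges.lean` — proofs-only
sibling of `SchoenfliesSphereThree.lean` (no definitions, no named facts). Each theorem below
closes a named fact `X : Prop` of that file as `X_holds : X` by composing an ACCEPTED
reduction theorem of the tree with the ACCEPTED unconditional `_holds` discharges of all of
its hypotheses; nothing is re-proved and no statement is changed. Recorded by the librarian
sweep g25 (2026-08-16, pass 5c: facts dischargeable in one line from the tree's own lemmas),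
so that the facts census, `#h21_route_deps` and the cone guardrail see these facts as
theorems.

Discharged here:

* `schoenflies_exists_ambientIsotopy_image_eq_sphereEquator_holds` :=
  `schoenflies_exists_ambientIsotopy_image_eq_sphereEquator_of_ball`
  `schoenflies_exists_ball_holds` (`SchoenfliesIsotopy.lean`).

## References

* [Schultens2014] — see `lean/references.bib` and the docstring of the fact in `SchoenfliesSphereThree.lean`.
-/

namespace Literature.Topology.FourManifolds.SphereEmbedding

/-- **Discharge of the named fact `schoenflies_exists_ambientIsotopy_image_eq_sphereEquator`**
(`SchoenfliesSphereThree.lean`): Alexander's theorem / Schoenflies theorem in `S³`, isotopy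
form. Every smoothly embedded 2-sphere in `𝕊 3` is carried onto the standard equator
`sphereEquator 2 = {x | x₃ = 0}` by an ambient isotopy of `𝕊 3` (as a subset; … — obtained as
`schoenflies_exists_ambientIsotopy_image_eq_sphereEquator_of_ball` applied to the tree's
unconditional discharge `schoenflies_exists_ball_holds` of its hypothesis (reduction in
`SchoenfliesIsotopy.lean`).
[cite: Schultens2014, §4.1 (PDF p. 71) with Thm. 3.2.5 (PDF p. 43)] -/
theorem schoenflies_exists_ambientIsotopy_image_eq_sphereEquator_holds :
    schoenflies_exists_ambientIsotopy_image_eq_sphereEquator :=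
  schoenflies_exists_ambientIsotopy_image_eq_sphereEquator_of_ball schoenflies_exists_ball_holds

end Literature.Topology.FourManifolds.SphereEmbedding
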